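import Summits.Ventures.LatticeQCDFlow.Exactness.IMHWarmStartSandwich
import Summits.Ventures.LatticeQCDFlow.Exactness.IMHAnyStartBurnIn
import HarnessLib

/-!
# The hot start of flow-MCMC: a fresh draw from the flow is the exact mixture `A·π + (1 − A)·q'`, so every any-start law
# holds from the hot start with one update's credit — `P_q ∘ θ_b⁻¹ = (1 − r^{b+1})·P_π + r^{b+1}·P_ν`

HONEST FRAMING: exact (Metropolis-corrected) sampling algorithms for lattice gauge theory;
figures of merit are autocorrelation/cost numbers at stated couplings and volumes; no
continuum-physics claim.

Venture `LatticeQCDFlow` (cell pub-lqcd), topic `Exactness`; FANOUT row 30 (lean-1, GEN-34).  NEW WORK of the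
cell, general state space.  In practice a flow-MCMC run starts from a draw of the flow itself (`μ₀ = q`, the HOT start;
GEN-31 `IMHHotStartAcceptance`: its first step is accepted with probability `≥ 1/2`).  Since `q = (1/w)·π` and
`1/w ≥ 1/w(x₀) = A` (`IMHWarmStartSandwich.hotStart_ge_target`), the hot start DECOMPOSES EXACTLY as
`q = A·π + (1 − A)·q'` with `q'` a probability law (§1) — a fraction `A` of hot-started runs ARE equilibrium runs from
time `0`.  With the any-start path law of `Exactness/IMHAnyStartPathSplit`:

* §1 **`hotStart_eq_mixture`** — `w(x₀) > 1`: `q = A·π + (1 − A)·q'`, `q' = (q − A·π)/(1 − A)` a probability law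
  (Mathlib `Measure.sub`); **`imh_chain_hotStart_eq_mixture`** — `P_q = A·P_π + (1 − A)·P_{q'}`.
* §2 **`imh_chain_shift_hotStart_exists`** — THE HOT START IS ONE UPDATE AHEAD, AS A LAW: for every `b` there is a
  probability law `ν` with `P_q ∘ θ_b⁻¹ = (1 − r^{b+1})·P_π + r^{b+1}·P_ν` (`w(x₀) ≥ 1`) — the any-start law with `b + 1`
  in place of `b`; hence every consequence of `IMHAnyStartPathSplit` ∕ `…Coverage` ∕ `…BurnIn` holds from the hot
  start with the exponent raised by one:
* §3 **`imh_chain_shift_integral_hotStart_abs_le`** — `|E_q[F(X_{b+·})] − E_π[F]| ≤ r^{b+1}·(c − a)` for every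
  measurable statistic `a ≤ F ≤ c`; **`imh_chain_shift_real_hotStart_abs_le`** — `|P_q(X_{b+·} ∈ E) − P_π(E)| ≤ r^{b+1}`;
  **`imh_chain_hotStart_real_ge`** — with NO discarded update, `P_q(E) ≥ A·P_π(E)` for every measurable set of runs;
  **`imh_chain_coverage_hotStart`** — `P_π(E) ≥ 1 − α ⇒ P_q(X_{b+·} ∈ E) ≥ (1 − r^{b+1})(1 − α)`.

Reading (gauge files): started from a draw of its own autoregressive proposal, an exact gauge sampler's every
statistic after `b` discarded configurations is within `(1 − A)^{b+1}` × its range of the equilibrium value.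
NOT CLAIMED: that the hot start beats the cold start by more than one update (no lower bound on its distortion is
asserted); the law `q'` beyond its existence; any value of `A`.

No `sorry`, no new definitions, nothing cited as a fact; general measurable space.
-/

noncomputable section

namespace Summit.Ventures.LatticeQCDFlow.Exactness

open MeasureTheory ProbabilityTheory Function
open scoped ENNReal
open Summit.Ventures.LatticeQCDFlow.Scoring Literature.Probability.MarkovChains

variable {Ω : Type*} [MeasurableSpace Ω] {q : Measure Ω} [IsProbabilityMeasure q] {w : Ω → ℝ}

/-! ## §1 The hot start is the exact mixture `A·π + (1 − A)·q'` -/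

/-- **`q = A·π + (1 − A)·q'` with `q'` a probability law** (`w(x₀) > 1`; `q' = (1 − A)⁻¹·(q − A·π)`). [ours] -/
theorem hotStart_eq_mixture (hw : Measurable w) (hw0 : ∀ y, 0 < w y) {x₀ : Ω} (hmax : ∀ y, w y ≤ w x₀)
    (hlt : 1 < w x₀) [IsProbabilityMeasure (q.withDensity fun y => ENNReal.ofReal (w y))] :
    ∃ q' : Measure Ω, IsProbabilityMeasure q' ∧
      q = ENNReal.ofReal (w x₀)⁻¹ • (q.withDensity fun y => ENNReal.ofReal (w y)) +
        ENNReal.ofReal (1 - (w x₀)⁻¹) • q' := by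
  set π : Measure Ω := q.withDensity fun y => ENNReal.ofReal (w y) with hπ
  set ε : ℝ≥0∞ := ENNReal.ofReal (w x₀)⁻¹ with hε
  have hε1 : ε < 1 := ofReal_inv_lt_one_of_one_lt hlt
  have h1e : 1 - ε ≠ 0 := (tsub_pos_of_lt hε1).ne'
  have h1t : 1 - ε ≠ ⊤ := ne_top_of_le_ne_top ENNReal.one_ne_top tsub_le_self
  have hle : ε • π ≤ q := hotStart_ge_target hw hw0 hmax
  haveI : IsFiniteMeasure (ε • π) := ⟨by
    rw [Measure.smul_apply, smul_eq_mul, measure_univ, mul_one]; exact ENNReal.ofReal_lt_top⟩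
  set q' : Measure Ω := (1 - ε)⁻¹ • (q - ε • π) with hq'
  have hmass : (q - ε • π) Set.univ = 1 - ε := by
    rw [Measure.sub_apply MeasurableSet.univ hle, measure_univ, Measure.smul_apply, smul_eq_mul, measure_univ, mul_one]
  refine ⟨q', ⟨by rw [hq', Measure.smul_apply, smul_eq_mul, hmass, ENNReal.inv_mul_cancel h1e h1t]⟩, ?_⟩
  rw [← one_sub_ofReal_inv_eq hw0 x₀, ← hε, hq', smul_smul, ENNReal.mul_inv_cancel h1e h1t, one_smul, add_comm,
    Measure.sub_add_cancel_of_le hle]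

/-- **`P_q = A·P_π + (1 − A)·P_{q'}`**: a fraction `A` of hot-started runs are equilibrium runs from time `0`. [ours] -/
theorem imh_chain_hotStart_eq_mixture [Fact (Measurable w)] (hw0 : ∀ y, 0 < w y) {x₀ : Ω} (hmax : ∀ y, w y ≤ w x₀)
    (hlt : 1 < w x₀) [IsProbabilityMeasure (q.withDensity fun y => ENNReal.ofReal (w y))] :
    ∃ q' : Measure Ω, IsProbabilityMeasure q' ∧
      Kernel.trajMeasure (X := fun _ : ℕ => Ω) q
          (fun n : ℕ => (indepMH q w).comap (fun h : (i : ↥(Finset.Iic n)) → Ω => h ⟨n, Finset.mem_Iic.2 le_rfl⟩)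
            (measurable_pi_apply _)) =
        ENNReal.ofReal (w x₀)⁻¹ •
            Kernel.trajMeasure (X := fun _ : ℕ => Ω) (q.withDensity fun y => ENNReal.ofReal (w y))
              (fun n : ℕ => (indepMH q w).comap (fun h : (i : ↥(Finset.Iic n)) → Ω => h ⟨n, Finset.mem_Iic.2 le_rfl⟩)
                (measurable_pi_apply _)) +
          ENNReal.ofReal (1 - (w x₀)⁻¹) •
            Kernel.trajMeasure (X := fun _ : ℕ => Ω) q'
              (fun n : ℕ => (indepMH q w).comap (fun h : (i : ↥(Finset.Iic n)) → Ω => h ⟨n, Finset.mem_Iic.2 le_rfl⟩)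
                (measurable_pi_apply _)) := by
  obtain ⟨q', hq', h⟩ := hotStart_eq_mixture (q := q) Fact.out hw0 hmax hlt
  refine ⟨q', hq', ?_⟩
  -- rewrite the INITIAL law only (the kernel keeps its proposal `q`)
  have hinit := congrArg (fun μ : Measure Ω => Kernel.trajMeasure (X := fun _ : ℕ => Ω) μ
    (fun n : ℕ => (indepMH q w).comap (fun h : (i : ↥(Finset.Iic n)) → Ω => h ⟨n, Finset.mem_Iic.2 le_rfl⟩)
      (measurable_pi_apply _))) h
  rw [hinit, chain_add_smul]

/-! ## §2 One update's credit: the hot start's shifted law -/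

/-- **THE HOT START IS ONE UPDATE AHEAD, AS A LAW**: for every `b` there is a probability law `ν` with
`P_q ∘ θ_b⁻¹ = (1 − r^{b+1})·P_π + r^{b+1}·P_ν` (`w(x₀) ≥ 1`). [ours] -/
theorem imh_chain_shift_hotStart_exists [Fact (Measurable w)] (hw0 : ∀ y, 0 < w y) {x₀ : Ω}
    (hmax : ∀ y, w y ≤ w x₀) [IsProbabilityMeasure (q.withDensity fun y => ENNReal.ofReal (w y))] (b : ℕ) :
    ∃ ν : Measure Ω, IsProbabilityMeasure ν ∧
      (Kernel.trajMeasure (X := fun _ : ℕ => Ω) q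
          (fun n : ℕ => (indepMH q w).comap (fun h : (i : ↥(Finset.Iic n)) → Ω => h ⟨n, Finset.mem_Iic.2 le_rfl⟩)
            (measurable_pi_apply _))).map (fun (x : ℕ → Ω) (n : ℕ) => x (b + n)) =
        ENNReal.ofReal (1 - (1 - (w x₀)⁻¹) ^ (b + 1)) •
            Kernel.trajMeasure (X := fun _ : ℕ => Ω) (q.withDensity fun y => ENNReal.ofReal (w y))
              (fun n : ℕ => (indepMH q w).comap (fun h : (i : ↥(Finset.Iic n)) → Ω => h ⟨n, Finset.mem_Iic.2 le_rfl⟩)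
                (measurable_pi_apply _)) +
          ENNReal.ofReal ((1 - (w x₀)⁻¹) ^ (b + 1)) •
            Kernel.trajMeasure (X := fun _ : ℕ => Ω) ν
              (fun n : ℕ => (indepMH q w).comap (fun h : (i : ↥(Finset.Iic n)) → Ω => h ⟨n, Finset.mem_Iic.2 le_rfl⟩)
                (measurable_pi_apply _)) := by
  set π : Measure Ω := q.withDensity fun y => ENNReal.ofReal (w y) with hπ
  have hW : 1 ≤ w x₀ := one_le_of_mode (q := q) hmax
  have ha0 : 0 ≤ (w x₀)⁻¹ := inv_nonneg.mpr (hw0 x₀).le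
  have hr0 : 0 ≤ 1 - (w x₀)⁻¹ := sub_nonneg.2 (inv_le_one_of_one_le₀ hW)
  have hr1 : 1 - (w x₀)⁻¹ ≤ 1 := sub_le_self _ ha0
  have hΘ : Measurable (fun (x : ℕ → Ω) (n : ℕ) => x (b + n)) :=
    measurable_pi_lambda _ fun n => measurable_pi_apply _
  rcases hW.lt_or_eq with hlt | h1
  · obtain ⟨q', hq', hmix⟩ := imh_chain_hotStart_eq_mixture (q := q) hw0 hmax hlt
    obtain ⟨ν, hν, hshift⟩ := imh_chain_shift_anyStart_exists (q := q) hw0 hmax q' b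
    refine ⟨ν, hν, ?_⟩
    rw [hmix, Measure.map_add _ _ hΘ, Measure.map_smul, Measure.map_smul, imh_chain_stationary_shift hw0 b, hshift,
      smul_add, smul_smul, smul_smul, ← add_assoc, ← add_smul, ← ENNReal.ofReal_mul hr0, ← ENNReal.ofReal_mul hr0,
      ← ENNReal.ofReal_add ha0 (mul_nonneg hr0 (sub_nonneg.2 (pow_le_one₀ hr0 hr1)))]
    congr 3 <;> ring
  · -- `w(x₀) = 1`: `r = 0`, the hot start IS the target and the run is the equilibrium run
    refine ⟨π, inferInstance, ?_⟩
    have hq1 : q = π := by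
      have h := hotStart_ge_target (q := q) Fact.out hw0 hmax
      rw [← h1, inv_one, ENNReal.ofReal_one, one_smul] at h
      -- `π ≤ q` between probability laws forces equality
      refine Measure.ext fun B hB => le_antisymm ?_ (Measure.le_iff'.1 h B)
      have hc : π Bᶜ ≤ q Bᶜ := Measure.le_iff'.1 h Bᶜ
      have hq : q B = 1 - q Bᶜ := by
        rw [← prob_add_prob_compl (μ := q) hB, ENNReal.add_sub_cancel_right (measure_ne_top _ _)]
      have hp : π B = 1 - π Bᶜ := by
        rw [← prob_add_prob_compl (μ := π) hB, ENNReal.add_sub_cancel_right (measure_ne_top _ _)]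
      rw [hq, hp]
      exact tsub_le_tsub_left hc 1
    have hinit := congrArg (fun μ : Measure Ω => (Kernel.trajMeasure (X := fun _ : ℕ => Ω) μ
      (fun n : ℕ => (indepMH q w).comap (fun h : (i : ↥(Finset.Iic n)) → Ω => h ⟨n, Finset.mem_Iic.2 le_rfl⟩)
        (measurable_pi_apply _))).map (fun (x : ℕ → Ω) (n : ℕ) => x (b + n))) hq1
    rw [hinit, imh_chain_stationary_shift hw0 b, ← h1]
    have e1 : ENNReal.ofReal (1 - (1 - (1 : ℝ)⁻¹) ^ (b + 1)) = 1 := by simp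
    have e2 : ENNReal.ofReal ((1 - (1 : ℝ)⁻¹) ^ (b + 1)) = 0 := by simp
    rw [e1, e2, one_smul, zero_smul, add_zero]

/-! ## §3 Consequences: every any-start law from the hot start, with the exponent raised by one -/

/-- **EVERY STATISTIC FROM THE HOT START**: for measurable `F` with `a ≤ F ≤ c` and every `b`,
`|E_q[F(X_{b+·})] − E_π[F]| ≤ r^{b+1}·(c − a)`. [ours] -/
theorem imh_chain_shift_integral_hotStart_abs_le [Fact (Measurable w)] (hw0 : ∀ y, 0 < w y) {x₀ : Ω}
    (hmax : ∀ y, w y ≤ w x₀) [IsProbabilityMeasure (q.withDensity fun y => ENNReal.ofReal (w y))]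
    {F : (ℕ → Ω) → ℝ} (hF : Measurable F) {a c : ℝ} (ha : ∀ x, a ≤ F x) (hc : ∀ x, F x ≤ c) (b : ℕ) :
    |∫ x, F (fun n => x (b + n)) ∂(Kernel.trajMeasure (X := fun _ : ℕ => Ω) q
        (fun n : ℕ => (indepMH q w).comap (fun h : (i : ↥(Finset.Iic n)) → Ω => h ⟨n, Finset.mem_Iic.2 le_rfl⟩)
          (measurable_pi_apply _))) - ∫ x, F x ∂(Kernel.trajMeasure (X := fun _ : ℕ => Ω) (q.withDensity fun y => ENNReal.ofReal (w y))
        (fun n : ℕ => (indepMH q w).comap (fun h : (i : ↥(Finset.Iic n)) → Ω => h ⟨n, Finset.mem_Iic.2 le_rfl⟩)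
          (measurable_pi_apply _)))| ≤ (1 - (w x₀)⁻¹) ^ (b + 1) * (c - a) := by
  obtain ⟨ν, hν, h⟩ := imh_chain_shift_hotStart_exists (q := q) hw0 hmax b
  have hW : 1 ≤ w x₀ := one_le_of_mode (q := q) hmax
  have hr0 : 0 ≤ 1 - (w x₀)⁻¹ := sub_nonneg.2 (inv_le_one_of_one_le₀ hW)
  have hr1 : 1 - (w x₀)⁻¹ ≤ 1 := sub_le_self _ (inv_nonneg.mpr (hw0 x₀).le)
  have hc0 : 0 ≤ 1 - (1 - (w x₀)⁻¹) ^ (b + 1) := sub_nonneg.2 (pow_le_one₀ hr0 hr1)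
  have hC : ∀ x, |F x| ≤ max |a| |c| := fun x => abs_le_max_abs_abs (ha x) (hc x)
  have hΘ : Measurable (fun (x : ℕ → Ω) (n : ℕ) => x (b + n)) :=
    measurable_pi_lambda _ fun n => measurable_pi_apply _
  rw [← integral_map hΘ.aemeasurable hF.aestronglyMeasurable, h,
    integral_add_measure ((integrable_of_bounded _ hF hC).smul_measure ENNReal.ofReal_ne_top)
      ((integrable_of_bounded _ hF hC).smul_measure ENNReal.ofReal_ne_top),
    integral_smul_measure, integral_smul_measure, ENNReal.toReal_ofReal hc0,
    ENNReal.toReal_ofReal (pow_nonneg hr0 (b + 1)), smul_eq_mul, smul_eq_mul]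
  set Pπ := (Kernel.trajMeasure (X := fun _ : ℕ => Ω) (q.withDensity fun y => ENNReal.ofReal (w y))
        (fun n : ℕ => (indepMH q w).comap (fun h : (i : ↥(Finset.Iic n)) → Ω => h ⟨n, Finset.mem_Iic.2 le_rfl⟩)
          (measurable_pi_apply _)))
  set Pν := Kernel.trajMeasure (X := fun _ : ℕ => Ω) ν
    (fun n : ℕ => (indepMH q w).comap (fun h : (i : ↥(Finset.Iic n)) → Ω => h ⟨n, Finset.mem_Iic.2 le_rfl⟩)
      (measurable_pi_apply _))
  obtain ⟨hπa, hπc⟩ := integral_mem_Icc_of_bounds Pπ hF ha hc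
  obtain ⟨hνa, hνc⟩ := integral_mem_Icc_of_bounds Pν hF ha hc
  rw [abs_le]
  constructor <;> nlinarith [pow_nonneg hr0 (b + 1)]

/-- **EVERY EVENT FROM THE HOT START**: `|P_q(X_{b+·} ∈ E) − P_π(E)| ≤ r^{b+1}` for every measurable set of runs.
[ours] -/
theorem imh_chain_shift_real_hotStart_abs_le [Fact (Measurable w)] (hw0 : ∀ y, 0 < w y) {x₀ : Ω}
    (hmax : ∀ y, w y ≤ w x₀) [IsProbabilityMeasure (q.withDensity fun y => ENNReal.ofReal (w y))]
    {E : Set (ℕ → Ω)} (hE : MeasurableSet E) (b : ℕ) :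
    |(Kernel.trajMeasure (X := fun _ : ℕ => Ω) q
        (fun n : ℕ => (indepMH q w).comap (fun h : (i : ↥(Finset.Iic n)) → Ω => h ⟨n, Finset.mem_Iic.2 le_rfl⟩)
          (measurable_pi_apply _))).real ((fun (x : ℕ → Ω) (n : ℕ) => x (b + n)) ⁻¹' E) - (Kernel.trajMeasure (X := fun _ : ℕ => Ω) (q.withDensity fun y => ENNReal.ofReal (w y))
        (fun n : ℕ => (indepMH q w).comap (fun h : (i : ↥(Finset.Iic n)) → Ω => h ⟨n, Finset.mem_Iic.2 le_rfl⟩)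
          (measurable_pi_apply _))).real E| ≤ (1 - (w x₀)⁻¹) ^ (b + 1) := by
  have hΘ : Measurable (fun (x : ℕ → Ω) (n : ℕ) => x (b + n)) :=
    measurable_pi_lambda _ fun n => measurable_pi_apply _
  have hb' : ∀ x, |E.indicator (1 : (ℕ → Ω) → ℝ) x| ≤ 1 := fun x => by
    by_cases hx : x ∈ E
    · rw [Set.indicator_of_mem hx, Pi.one_apply, abs_one]
    · rw [Set.indicator_of_notMem hx, abs_zero]; exact zero_le_one
  have h0 : ∀ x, (0 : ℝ) ≤ E.indicator 1 x := fun x => Set.indicator_nonneg (fun _ _ => zero_le_one) x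
  have h1 : ∀ x, E.indicator (1 : (ℕ → Ω) → ℝ) x ≤ 1 := fun x =>
    Set.indicator_le_self' (fun _ _ => zero_le_one) x |>.trans le_rfl
  rw [← integral_indicator_one (hΘ hE), ← integral_indicator_one hE]
  have h := imh_chain_shift_integral_hotStart_abs_le (q := q) hw0 hmax (F := E.indicator 1)
    (measurable_one.indicator hE) h0 h1 b (x₀ := x₀)
  rw [sub_zero, mul_one] at h
  refine le_trans (le_of_eq ?_) h
  congr 1

/-- **WITH NO DISCARDED UPDATE, A FRACTION `A` OF HOT-STARTED RUNS ARE EQUILIBRIUM RUNS**: `P_q(E) ≥ A·P_π(E)` for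
every measurable set of runs `E`. [ours] -/
theorem imh_chain_hotStart_real_ge [Fact (Measurable w)] (hw0 : ∀ y, 0 < w y) {x₀ : Ω}
    (hmax : ∀ y, w y ≤ w x₀) [IsProbabilityMeasure (q.withDensity fun y => ENNReal.ofReal (w y))]
    {E : Set (ℕ → Ω)} (hE : MeasurableSet E) :
    (w x₀)⁻¹ * (Kernel.trajMeasure (X := fun _ : ℕ => Ω) (q.withDensity fun y => ENNReal.ofReal (w y))
        (fun n : ℕ => (indepMH q w).comap (fun h : (i : ↥(Finset.Iic n)) → Ω => h ⟨n, Finset.mem_Iic.2 le_rfl⟩)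
          (measurable_pi_apply _))).real E ≤ (Kernel.trajMeasure (X := fun _ : ℕ => Ω) q
        (fun n : ℕ => (indepMH q w).comap (fun h : (i : ↥(Finset.Iic n)) → Ω => h ⟨n, Finset.mem_Iic.2 le_rfl⟩)
          (measurable_pi_apply _))).real E := by
  have h := imh_chain_shift_real_hotStart_ge (q := q) hw0 hmax hE 0
  simp only [zero_add, pow_one, sub_sub_cancel] at h
  exact h

/-- **THE COVERAGE GUARANTEE FROM THE HOT START**: `P_π(E) ≥ 1 − α ⇒ P_q(X_{b+·} ∈ E) ≥ (1 − r^{b+1})·(1 − α)`.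
[ours] -/
theorem imh_chain_coverage_hotStart [Fact (Measurable w)] (hw0 : ∀ y, 0 < w y) {x₀ : Ω}
    (hmax : ∀ y, w y ≤ w x₀) [IsProbabilityMeasure (q.withDensity fun y => ENNReal.ofReal (w y))]
    {E : Set (ℕ → Ω)} (hE : MeasurableSet E) (b : ℕ) {α : ℝ} (hcal : 1 - α ≤ (Kernel.trajMeasure (X := fun _ : ℕ => Ω) (q.withDensity fun y => ENNReal.ofReal (w y))
        (fun n : ℕ => (indepMH q w).comap (fun h : (i : ↥(Finset.Iic n)) → Ω => h ⟨n, Finset.mem_Iic.2 le_rfl⟩)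
          (measurable_pi_apply _))).real E) :
    (1 - (1 - (w x₀)⁻¹) ^ (b + 1)) * (1 - α) ≤ (Kernel.trajMeasure (X := fun _ : ℕ => Ω) q
        (fun n : ℕ => (indepMH q w).comap (fun h : (i : ↥(Finset.Iic n)) → Ω => h ⟨n, Finset.mem_Iic.2 le_rfl⟩)
          (measurable_pi_apply _))).real ((fun (x : ℕ → Ω) (n : ℕ) => x (b + n)) ⁻¹' E) := by
  refine le_trans ?_ (imh_chain_shift_real_hotStart_ge (q := q) hw0 hmax hE b)
  have hW : 1 ≤ w x₀ := one_le_of_mode (q := q) hmax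
  have hr0 : 0 ≤ 1 - (w x₀)⁻¹ := sub_nonneg.2 (inv_le_one_of_one_le₀ hW)
  have hr1 : 1 - (w x₀)⁻¹ ≤ 1 := sub_le_self _ (inv_nonneg.mpr (hw0 x₀).le)
  exact mul_le_mul_of_nonneg_left hcal (sub_nonneg.2 (pow_le_one₀ hr0 hr1))

end Summit.Ventures.LatticeQCDFlow.Exactness

end
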